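import Literature.Topology.FourManifolds.RadialExtension
import Literature.Topology.FourManifolds.SmaleDiffDisc
import HarnessLib

/-!
# Diffeomorphisms of Euclidean space that are a prescribed cone on a spherical shell
# (Cerf's radial extension, rescaled; in dimension `3` for every diffeomorphism of `S²`)

Topic `Literature/Topology/FourManifolds` (infrastructure for the endgame of the Torelli half of
Griffiths' handlebody theorem: the level conjugation of a boundary diffeomorphism along the
gradient-like trajectories is, in Milnor's radial chart at the minimum, the CONE
`v ↦ ‖v‖ · φ(v/‖v‖)` over a self-diffeomorphism `φ` of the sphere of directions — smooth off the
apex only; it is replaced inside a small ball by a diffeomorphism which agrees with the cone on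
a shell).  Everything here is **proved**.

* `Literature.Topology.FourManifolds.Diffeotopy.scaledRadialExtension D r` — Cerf's radial
  extension `x ↦ ‖x‖ · D_{‖x‖}(x/‖x‖)` (`RadialExtension.lean`; Cerf 1968, Ch. I §1, proof of
  Lemme 2) of a diffeotopy `D` of `𝕊ⁿ`, conjugated by the homothety of ratio `r > 0`: a
  self-diffeomorphism of `ℝⁿ⁺¹`, norm-preserving, equal to the cone `t • u ↦ t • D₁ u` on the
  shell `r/2 ≤ t ≤ r` (`scaledRadialExtension_smul_coe`) and linear (the identity) near `0`;
* `exists_diffeomorph_norm_eq_eq_cone_two` — **in dimension `3`, for EVERY diffeomorphism `φ`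
  of `S²` and every `r > 0` there is a norm-preserving self-diffeomorphism `Θ` of `ℝ³` with
  `Θ (t • u) = t • φ u` for `r/2 ≤ t ≤ r`**: by Smale's theorem in Cerf's form (every
  diffeomorphism of `S²` is diffeotopic to the identity or to a reflection,
  `Diffeomorph.isDiffeotopicToId_or_isDiffeotopic_sphereReflection_two`, `SmaleDiffDisc.lean`)
  `φ`, or `φ ∘ ρ` for a hyperplane reflection `ρ`, is the final stage of a diffeotopy, whose
  scaled radial extension (precomposed with the linear reflection in the second case) is `Θ`.

## References

* J. Cerf, *Sur les difféomorphismes de la sphère de dimension trois (Γ₄ = 0)*, LNM 53 (1968),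
  Ch. I §1, Lemme 2; Appendice §5, Théorème 4 (Smale), Corollaire 2. [CerfDiffeoSphere1968]
* S. Smale, *Diffeomorphisms of the 2-sphere*, Proc. AMS 10 (1959), 621–626. [Smale1959]
-/

open scoped Manifold ContDiff Topology
open Set Function Metric

noncomputable section

namespace Literature.Topology.FourManifolds

/-- Local notation: `𝔼 n` is the model Euclidean space `EuclideanSpace ℝ (Fin n)`. -/
local notation "𝔼 " n:arg => EuclideanSpace ℝ (Fin n)
/-- Local notation: `𝕊 n` is the unit sphere in `𝔼 (n + 1)`. -/
local notation "𝕊 " n:arg => (Metric.sphere (0 : EuclideanSpace ℝ (Fin (n + 1))) 1)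

variable {n : ℕ}

/-! ### The radial extension on the outer shell -/

/-- **On the shell `1/2 ≤ t` the radial extension is the cone over the final stage**:
`radialExtensionFun F (t • u) = t • F 1 u`. [cite: CerfDiffeoSphere1968, Ch. I §1, Lemme 2] -/
theorem radialExtensionFun_smul_coe (F : ℝ → (𝕊 n) → 𝕊 n) {t : ℝ} (ht : 1 / 2 ≤ t) (u : 𝕊 n) :
    radialExtensionFun F (t • (u : 𝔼 (n + 1))) = t • (F 1 u : 𝔼 (n + 1)) := by
  have ht0 : 0 < t := lt_of_lt_of_le (by norm_num) ht
  rw [radialExtensionFun, norm_smul_coe_sphere ht0.le, radialStep_of_ge ht, radialProjection_smul _ ht0]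

namespace Diffeotopy

/-- **The scaled radial extension** of a diffeotopy `D` of `𝕊ⁿ` at radius `r > 0`:
`v ↦ r • radialExtensionFun D (r⁻¹ • v)`, the conjugate of Cerf's radial extension by the
homothety of ratio `r`. [cite: CerfDiffeoSphere1968, Ch. I §1, Lemme 2] -/
def scaledRadialExtension (D : Diffeotopy (𝓡 n) (𝕊 n)) (r : ℝ) (hr : 0 < r) :
    𝔼 (n + 1) ≃ₘ⟮𝓘(ℝ, 𝔼 (n + 1)), 𝓘(ℝ, 𝔼 (n + 1))⟯ 𝔼 (n + 1) where
  toFun v := r • radialExtensionFun D.toFun (r⁻¹ • v)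
  invFun w := r • radialExtensionFun D.invFun (r⁻¹ • w)
  left_inv v := by
    simp only [smul_smul, inv_mul_cancel₀ hr.ne', one_smul,
      radialExtensionFun_radialExtensionFun D.invFun_toFun, mul_inv_cancel₀ hr.ne']
  right_inv w := by
    simp only [smul_smul, inv_mul_cancel₀ hr.ne', one_smul,
      radialExtensionFun_radialExtensionFun D.toFun_invFun, mul_inv_cancel₀ hr.ne']
  contMDiff_toFun :=
    (((contDiff_radialExtensionFun D.contMDiff_uncurry_toFun D.toFun_zero).comp
      (contDiff_const_smul r⁻¹)).const_smul r).contMDiff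
  contMDiff_invFun :=
    (((contDiff_radialExtensionFun D.contMDiff_uncurry_invFun D.invFun_zero).comp
      (contDiff_const_smul r⁻¹)).const_smul r).contMDiff

/-- The scaled radial extension as a function (definitional). [folklore] -/
theorem scaledRadialExtension_apply (D : Diffeotopy (𝓡 n) (𝕊 n)) {r : ℝ} (hr : 0 < r) (v : 𝔼 (n + 1)) :
    D.scaledRadialExtension r hr v = r • radialExtensionFun D.toFun (r⁻¹ • v) := rfl

/-- **The scaled radial extension preserves the norm.** [cite: CerfDiffeoSphere1968, Ch. I §1, Lemme 2] -/
theorem norm_scaledRadialExtension (D : Diffeotopy (𝓡 n) (𝕊 n)) {r : ℝ} (hr : 0 < r) (v : 𝔼 (n + 1)) :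
    ‖D.scaledRadialExtension r hr v‖ = ‖v‖ := by
  rw [scaledRadialExtension_apply, norm_smul, norm_radialExtensionFun, norm_smul, Real.norm_eq_abs,
    Real.norm_eq_abs, abs_of_pos hr, abs_of_pos (inv_pos.2 hr), ← mul_assoc, mul_inv_cancel₀ hr.ne', one_mul]

/-- **On the shell `r/2 ≤ t` the scaled radial extension is the cone over the final stage**:
`Θ (t • u) = t • D₁ u`. [cite: CerfDiffeoSphere1968, Ch. I §1, Lemme 2] -/
theorem scaledRadialExtension_smul_coe (D : Diffeotopy (𝓡 n) (𝕊 n)) {r : ℝ} (hr : 0 < r) {t : ℝ}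
    (ht : r / 2 ≤ t) (u : 𝕊 n) :
    D.scaledRadialExtension r hr (t • (u : 𝔼 (n + 1))) = t • (D.stage 1 u : 𝔼 (n + 1)) := by
  have h1 : 1 / 2 ≤ r⁻¹ * t := by
    rw [le_inv_mul_iff₀ hr]; linarith
  rw [scaledRadialExtension_apply, smul_smul, radialExtensionFun_smul_coe D.toFun h1 u, smul_smul,
    ← mul_assoc, mul_inv_cancel₀ hr.ne', one_mul, coe_stage]

end Diffeotopy

/-! ### Dimension `3`: every diffeomorphism of `S²` -/

/-- **A norm-preserving diffeomorphism of `ℝ³` which is the cone over a given diffeomorphism of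
`S²` on a given shell.**  For every `φ : 𝕊² ≃ₘ 𝕊²` and `r > 0` there is a self-diffeomorphism
`Θ` of `ℝ³` with `‖Θ v‖ = ‖v‖` for all `v` and `Θ (t • u) = t • φ u` whenever `r/2 ≤ t ≤ r`:
by Smale's theorem in Cerf's form `φ` is diffeotopic to the identity or to a hyperplane
reflection `ρ`; in the first case `Θ` is the scaled radial extension of a diffeotopy ending at
`φ`, in the second that of a diffeotopy ending at `φ ∘ ρ`, precomposed with the linear
reflection. [cite: CerfDiffeoSphere1968, Ch. I §1, Lemme 2; Appendice §5, Théorème 4, Corollaire 2] -/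
theorem exists_diffeomorph_norm_eq_eq_cone_two (φ : (𝕊 2) ≃ₘ⟮𝓡 2, 𝓡 2⟯ (𝕊 2)) {r : ℝ} (hr : 0 < r) :
    ∃ Θ : 𝔼 3 ≃ₘ⟮𝓘(ℝ, 𝔼 3), 𝓘(ℝ, 𝔼 3)⟯ 𝔼 3, (∀ v, ‖Θ v‖ = ‖v‖) ∧
      ∀ (t : ℝ) (u : 𝕊 2), r / 2 ≤ t → t ≤ r → Θ (t • (u : 𝔼 3)) = t • (φ u : 𝔼 3) := by
  rcases Diffeomorph.isDiffeotopicToId_or_isDiffeotopic_sphereReflection_two (sphereBasePoint 2) φ with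
    ⟨D, hD⟩ | h
  · refine ⟨D.scaledRadialExtension r hr, D.norm_scaledRadialExtension hr, fun t u ht _ => ?_⟩
    rw [D.scaledRadialExtension_smul_coe hr ht, hD]
  · obtain ⟨D, hD⟩ := h
    set v₀ : 𝕊 2 := sphereBasePoint 2 with hv₀
    set R : 𝔼 3 ≃ₗᵢ[ℝ] 𝔼 3 := (ℝ ∙ (v₀ : 𝔼 3))ᗮ.reflection with hR
    set Θ₁ := D.scaledRadialExtension r hr with hΘ₁
    refine ⟨R.toContinuousLinearEquiv.toDiffeomorph.trans Θ₁, fun v => ?_, fun t u ht _ => ?_⟩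
    · show ‖Θ₁ (R.toContinuousLinearEquiv.toDiffeomorph v)‖ = ‖v‖
      rw [ContinuousLinearEquiv.coe_toDiffeomorph, D.norm_scaledRadialExtension hr]
      exact R.norm_map v
    · show Θ₁ (R.toContinuousLinearEquiv.toDiffeomorph (t • (u : 𝔼 3))) = t • (φ u : 𝔼 3)
      rw [ContinuousLinearEquiv.coe_toDiffeomorph]
      have h1 : R.toContinuousLinearEquiv (t • (u : 𝔼 3)) = t • ((sphereReflection v₀ u : 𝕊 2) : 𝔼 3) := by
        rw [coe_sphereReflection]; exact map_smul _ t _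
      rw [h1, hΘ₁, D.scaledRadialExtension_smul_coe hr ht, hD]
      congr 2
      show φ ((sphereReflection v₀).symm (sphereReflection v₀ u)) = φ u
      rw [Diffeomorph.symm_apply_apply]

end Literature.Topology.FourManifolds
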